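import Literature.AlgebraicGeometry.ModuliOfAbelianVarieties.SiegelAdmissibleOfIso
import Literature.AlgebraicGeometry.AbelianSchemes.AbelianSchemeFibreHom
import Literature.AlgebraicGeometry.AbelianSchemes.AbelianSchemeOverFibreIdentity
import HarnessLib

/-!
# Admissibility along the D4 relation `IsBaseChangeVia` over `𝟙 (Spec ℂ)` — the X / level half ([MFK94] Def. 7.2–7.3)

Topic `Literature/AlgebraicGeometry/ModuliOfAbelianVarieties`; cell hodgecm-mathlib, U-DAG v0.1 §2 GLUE `U_of` row (α),
SECOND HALF (B-plan1 R54; sequel of ★ `SiegelAdmissibleOfIso`, which proved the FIBRE FORM `isAdmissibleAt_of_fibreIso`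
from `(e, he, hpol)`).  Here the fibre isomorphism `e` and its section clause `he` are PRODUCED from the D4 relation
`P″.IsBaseChangeVia P′` along `𝟙` ([MumfordFogartyKirwan1994] Def. 7.3 read at `f = 𝟙`: «an isomorphism of triples»):

* §1 `AbelianSchemeOver.exists_iso_of_isBaseChangeVia_id` — CONVERSE of ★ (c-i) `isBaseChangeVia_id_of_isMonHom`
  (`AbelianSchemeOverFibreIdentity`): a base change of group schemes along `𝟙 S` through `G` IS an isomorphism of `S`-group
  schemes `e : X′ ≅ X` with `e.hom.left = G` (`G` is an isomorphism as the pull-back of `𝟙 S`, Mathlib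
  `IsPullback.isIso_fst_of_isIso`; the unit / multiplication clauses are `IsMonHom` read through `Over.tensorHom_left`).
* §2 `AbelianSchemeOver.map_fibreIsoOfIso_restrictPt_of_comp_eq` — the induced fibre isomorphism ★ `fibreIsoOfIso e s`
  carries `σ′(s)` to `σ(s)` whenever `σ′ ≫ G = σ` on underlying schemes (★ `fibrePointToLeft_map_fibreHom`,
  `fibrePointToLeft_injective`), hence the LEVEL clause of `LevelStructure.IsBaseChangeVia` along `𝟙` gives the `he` of the
  fibre form (`levelStructure_he_of_isBaseChangeVia_id`).
* §3 `isAdmissibleAt_of_isBaseChangeVia_id` — the D4-relation form of (α) MODULO the polarisation transfer `hpol` (kept as a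
  hypothesis on the produced `e`: ampleness + `IsLambdaOfAt` across the two `DualPair`s from the hat / Poincaré / λ clauses is
  the converse of Road-S K2/K3 and is not in this file).

Theorems only; no definition, no named fact, no instance, no `sorry`.  HC_CM is proved only modulo the 7 printed citations
until rung 0 closes; nothing here discharges a binder.

## References
* [MumfordFogartyKirwan1994] D. Mumford, J. Fogarty, F. Kirwan, *Geometric Invariant Theory*, 3rd ed., Ch. 7 §2 Def. 7.2–7.3
  (pp. 129–130).
* [Milne2005ShimuraVarieties] J. S. Milne, *Introduction to Shimura Varieties* (2005/2017), §6 Thm. 6.11 pp. 74–75.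
* [GortzWedhorn2020] U. Görtz, T. Wedhorn, *Algebraic Geometry I*, 2nd ed., Section (4.7) (p. 135).
-/

noncomputable section

open CategoryTheory CategoryTheory.Limits AlgebraicGeometry MonoidalCategory

universe u

namespace Literature.AlgebraicGeometry.AbelianSchemes

namespace AbelianSchemeOver

open Literature.AlgebraicGeometry.Motives
open scoped MonObj

variable {S : Scheme.{u}} {A' A : AbelianSchemeOver S}

/-! ## §1 Converse of (c-i): a base change along `𝟙 S` is an isomorphism of `S`-group schemes -/

/-- **A base change of group schemes along `𝟙 S` through `G` is an isomorphism of `S`-group schemes with underlying map `G`**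
(converse of ★ `isBaseChangeVia_id_of_isMonHom`): `G` is the pull-back of the isomorphism `𝟙 S`, hence an isomorphism
(`IsPullback.isIso_fst_of_isIso`); the unit and multiplication clauses of `IsBaseChangeVia` are exactly `IsMonHom` for
`Over.isoMk (asIso G)` read on underlying schemes (`Over.tensorHom_left`).  [MumfordFogartyKirwan1994] Def. 7.3 at `f = 𝟙`:
the pull-back relation along the identity is an isomorphism of (group) schemes over `S`.
[cite: MumfordFogartyKirwan1994, Ch. 7 §2 Definition 7.3 (p. 130)] [cite: GortzWedhorn2020, Section (4.7) (p. 135)] -/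
theorem exists_iso_of_isBaseChangeVia_id {G : A'.X.left ⟶ A.X.left} (h : A'.IsBaseChangeVia A (𝟙 S) G) :
    ∃ e : A'.X ≅ A.X, e.hom.left = G ∧ IsMonHom e.hom := by
  obtain ⟨w, hpb, hunit, hmul⟩ := h
  haveI : IsIso G := hpb.isIso_fst_of_isIso
  have w' : G ≫ A.X.hom = A'.X.hom := by rw [w, Category.comp_id]
  refine ⟨Over.isoMk (asIso G) w', rfl, ⟨?_, ?_⟩⟩
  · ext
    rw [Over.comp_left]
    change η[A'.X].left ≫ G = η[A.X].left
    rw [hunit, Category.id_comp]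
  · ext
    rw [Over.comp_left, Over.comp_left, Over.tensorHom_left]
    exact hmul

/-! ## §2 The induced fibre isomorphism carries `σ′(s)` to `σ(s)` -/

variable {Ω : Type u} [Field Ω]

/-- **If `σ′ ≫ e = σ` on underlying schemes, the fibre isomorphism `e_s` carries the point `σ′(s)` to `σ(s)`**: both have the
same underlying point `s ≫ σ′ ≫ G = s ≫ σ` of `X` (★ `fibrePointToLeft_map_fibreHom`, `restrictPt_left_fst`), and an
`Ω`-point of the fibre is determined by its point of `X` (★ `fibrePointToLeft_injective`).
[cite: MumfordFogartyKirwan1994, Ch. 7 §1 Definition 7.1 (p. 129) and §2 Definition 7.3 (p. 130)] -/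
theorem map_fibreIsoOfIso_restrictPt_of_comp_eq (e : A'.X ≅ A.X) [IsMonHom e.hom] (s : Spec (.of Ω) ⟶ S)
    (σ' : A'.Sections) (σ : A.Sections) (hσ : σ'.left ≫ e.hom.left = σ.left) :
    AlgPoints.map (fibreIsoOfIso e s).hom.hom.hom.hom (A'.restrictPt s σ') = A.restrictPt s σ := by
  apply fibrePointToLeft_injective s
  rw [fibreIsoOfIso_hom_eq_fibreHom, fibrePointToLeft_map_fibreHom]
  change ((A'.restrictPt s σ').left ≫ pullback.fst A'.X.hom s) ≫ e.hom.left = (A.restrictPt s σ).left ≫ pullback.fst A.X.hom s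
  rw [restrictPt_left_fst, restrictPt_left_fst, ← hσ]
  exact Category.assoc _ _ _

/-- **The level clause along `𝟙 S` gives the section hypothesis `he` of the fibre form**: if `φ′.IsBaseChangeVia φ (𝟙 S) G`
and `e` is the isomorphism of `S`-group schemes with `e.hom.left = G` (§1), then `e_s(σ′ᵢ(s)) = σᵢ(s)` for every `i` and
every field-valued point `s`. [cite: MumfordFogartyKirwan1994, Ch. 7 §2 Definition 7.3 (p. 130)] -/
theorem levelStructure_he_of_isBaseChangeVia_id {g n : ℕ} {φ' : A'.LevelStructure g n} {φ : A.LevelStructure g n}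
    {G : A'.X.left ⟶ A.X.left} (h : φ'.IsBaseChangeVia φ (𝟙 S) G) (e : A'.X ≅ A.X) [IsMonHom e.hom]
    (heG : e.hom.left = G) (s : Spec (.of Ω) ⟶ S) (i : Fin g ⊕ Fin g) :
    AlgPoints.map (fibreIsoOfIso e s).hom.hom.hom.hom (A'.restrictPt s (φ'.σ i)) = A.restrictPt s (φ.σ i) := by
  refine map_fibreIsoOfIso_restrictPt_of_comp_eq e s (φ'.σ i) (φ.σ i) ?_
  rw [heG, h.2 i, Category.id_comp]

end AbelianSchemeOver

end Literature.AlgebraicGeometry.AbelianSchemes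

/-! ## §3 The D4-relation form of (α), modulo the polarisation transfer -/

namespace Literature.AlgebraicGeometry.ModuliOfAbelianVarieties

open Literature.AlgebraicGeometry.Motives (SchemeOver ComplexPoints AlgPoints specOver AbelianVariety CartierDivisor)
open Literature.AlgebraicGeometry.AbelianSchemes (PolarizedAbelianSchemeWithLevel AbelianSchemeOver)
open Literature.NumberTheory.Automorphic (siegelUpperHalfSpace)

/-- **ADMISSIBILITY ALONG AN ISOMORPHISM OF TRIPLES, X / LEVEL HALF** ([MumfordFogartyKirwan1994] Def. 7.2 «up to
isomorphism»; [Milne2005ShimuraVarieties] Thm. 6.11): if `P″` is related to `P′` along `𝟙 (Spec ℂ)` through `(G, Ĝ)` (D4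
`IsBaseChangeVia`), then the X / level clauses alone produce the isomorphism of `Spec ℂ`-group schemes `e : X″ ≅ X′` with
`e.hom.left = G` (§1) whose fibre isomorphism carries the level sections (§2); GIVEN the polarisation transfer `hpol` along
that fibre isomorphism (every ample `IsLambdaOfAt` witness of `P′` pulls back to one of `P″` — the converse-K2/K3 half, a
hypothesis here), admissibility at `(Z, r)` passes from `P′` to `P″` by ★ `isAdmissibleAt_of_fibreIso`.
[cite: MumfordFogartyKirwan1994, Ch. 7 §2 Definition 7.2 (p. 129) and Definition 7.3 (p. 130)]
[cite: Milne2005ShimuraVarieties, §6 Thm. 6.11 pp. 74–75] -/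
theorem isAdmissibleAt_of_isBaseChangeVia_id {g N : ℕ} {δ : Fin g → ℕ} (hδ : IsPolarizationType δ) {r : gspFinAdelic δ}
    {Z : Matrix (Fin g) (Fin g) ℂ} {hZ : Z ∈ siegelUpperHalfSpace g}
    {P' P'' : PolarizedAbelianSchemeWithLevel g N δ (specOver ℚ ℂ).left}
    {G : P''.A.X.left ⟶ P'.A.X.left} {Ĝ : P''.D.hat.X.left ⟶ P'.D.hat.X.left}
    (hBC : P''.IsBaseChangeVia P' (𝟙 (specOver ℚ ℂ) : specOver ℚ ℂ ⟶ specOver ℚ ℂ).left G Ĝ)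
    (hpol : ∀ (e : P''.A.X ≅ P'.A.X) [IsMonHom e.hom], e.hom.left = G →
      ∀ Θ : CartierDivisor (P'.A.fibre (𝟙 (Spec (CommRingCat.of ℂ)))).toAbelianVariety.X.left,
        Θ.IsAmple → P'.A.IsLambdaOfAt (𝟙 (Spec (CommRingCat.of ℂ))) P'.D P'.pol.lam Θ →
          haveI := AbelianVariety.isDominant_toSchemeHom_iso_hom
            (AbelianSchemeOver.fibreIsoOfIso e (𝟙 (Spec (CommRingCat.of ℂ))))
          (Θ.pullback (AbelianVariety.Hom.toSchemeHom
              (AbelianSchemeOver.fibreIsoOfIso e (𝟙 (Spec (CommRingCat.of ℂ)))).hom)).IsAmple ∧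
            P''.A.IsLambdaOfAt (𝟙 (Spec (CommRingCat.of ℂ))) P''.D P''.pol.lam
              (Θ.pullback (AbelianVariety.Hom.toSchemeHom
                (AbelianSchemeOver.fibreIsoOfIso e (𝟙 (Spec (CommRingCat.of ℂ)))).hom)))
    (h : IsAdmissibleAt hδ r Z hZ P') : IsAdmissibleAt hδ r Z hZ P'' := by
  obtain ⟨e, heG, hmon⟩ := AbelianSchemeOver.exists_iso_of_isBaseChangeVia_id hBC.1.1
  haveI := hmon
  exact isAdmissibleAt_of_fibreIso hδ (AbelianSchemeOver.fibreIsoOfIso e (𝟙 (Spec (CommRingCat.of ℂ))))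
    (fun i => AbelianSchemeOver.levelStructure_he_of_isBaseChangeVia_id hBC.1 e heG _ i) (hpol e heG) h

end Literature.AlgebraicGeometry.ModuliOfAbelianVarieties

end
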